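import Summits.QuantumFields.BalabanUV.Beta.GAN24.ExitFaceHalfVertexSplit
import Summits.QuantumFields.BalabanUV.Beta.GAN24.ConstantSlotGaugeTower

/-!
# `BalabanUV.Beta.GAN24.ExitFaceSlotStaircase` — binder row G-an2-4 ∕ (CONV-C), W-slot (α-0), ROW (C) AT LEVELS `j ≥ 1`, (W4)∕(W7) of the (γ) hand's memo
# `HOME/b2b-balaban-gan24-formalise-leaf-06/g52/C-LEVELS-GE1.md` §22 CLOSED BY THE STAIRCASE: **THE EXIT-FACE PROFILE IS A GRADIENT (`χ_ν = d⌊·_ν∕Lc⌋`), SO THE CUBIC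
# GAUGE LETTER L1′ EVALUATES EVERY SLOT SUM OF THE VALUE THIRD JET IN CLOSED FORM —
# `Σ'_t V_j ν t (x,z)_{ab} = ½·E2_{j+1}(x,z)_{ab}·(z_ν − x_ν)`, `Σ'_t χ_ν(t)·V_j ν t (x,z)_{ab} = ½·E2_{j+1}(x,z)_{ab}·(⌊z_ν∕Lc⌋ − ⌊x_ν∕Lc⌋)`, and THE TWO-FACE CURRENTS
# OF THE E-SECTOR EE WORD ARE VALUE-HESSIAN IMAGES OF «STAIRCASE × EXIT FACE»: `FF_R(b,z) = ½·Σ'_{s′} E2_{j+1}(z,s′)_{bβ}·⌊s′_ν∕Lc⌋·χ_β(s′)`,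
# `FF_L(a,x) = −½·Σ'_y ⌊y_μ∕Lc⌋·χ_α(y)·E2_{j+1}(y,x)_{αa}`** (`V_j = e3OfK Lc G_j (SrecAt … j)`, `E2_{j+1} = E2 d Lc (j+1)`, `χ_ν(t) = [t_ν % Lc = Lc−1]`; every `j`, in-block
# root, every `d`, `Lc ≥ 1`) (G-an2-4 CRUX TEAM (2), seat `b2b-balaban-gan24-formalise-leaf-06` = the (γ) hand, gen 53; journal INTENT I-leaf06-g53-1)

NOT IN PRINT; OUR BOOKKEEPING ([folklore] BY NAME: this lineage's L1′ `CubicGaugeLetterLinearGrowth.tsum_grad_mul_e3OfK_SrecAt_inl_inl` (the cubic background gauge letter for gauge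
functions of linear growth) fed the COORDINATE `t ↦ t_ν` and the STAIRCASE `t ↦ ⌊t_ν∕Lc⌋` (D1 `ValueHessianLinearGauge.staircase_grad ∕ abs_staircase_le`: its gradient is the exit-face
indicator), D1 `tsum_E2_mul_exitFace_eq_zero′ ∕ tsum_exitFace_mul_E2_eq_zero′` (the value Hessian kills the exit-face profile), (W3) `ExitFaceHalfVertexSplit.summable_E2_mul_linGrowth_face ∕
summable_linGrowth_face_mul_E2`, and gen 52's `ConstantSlotGaugeTower.tsum_slot_e3OfK_inl_inl`; 0 `def`, 0 cited fact, 0 `def … : Prop`, 0 sorry).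
HONEST FRAMING (cell contract, verbatim): «discharging `BetaPertH` makes Bałaban's UV stability UNCONDITIONAL — a real constructive-QFT result; it is NOT the continuum
limit and NOT the Clay problem.»  HONEST DEPENDENCY (verbatim): «continuum YM on T⁴ ⇐ BetaPertH ∧ nine spine estimates (0/9 proved); BetaPertH ⇐ (D1) ∧ (D4) ∧ CAP+tail;
G-an2-4 gates asym, D1 and NE2/3/4.»

WHY (memo §22; ENGINE E-leaf06-g53-1∕2 = kit j201825 ∕ j201877, D = 2, levels 0 and 1, weight 0: the kernel-leg closed form `S^E(c̃_ν) ĝ_β = −s·E2(λ̂_β ĉ_ν)` to 1e-16, the full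
dressed half-vertices as `E2`-images to 8e-16, the full two-face E-sector EE word `= κ_j·Σ_sym a_Lᵀ E2_j a_R` to 10 digits with the `|A∧a|²` pattern ratio `EX(0011) : EX(0101) = −2 : 1`).
Gen 52 split the exit-face background `Lc·χ_ν = ĉ_ν − dσ_ν` into a constant slot (the «tower» `τ`, left open as (W4)∕(W7)) and a sawtooth gauge (the `e` letter).  But the exit-face
indicator is ITSELF a pure gauge of linear growth — `χ_ν(t) = ⌊(t + e_ν)_ν∕Lc⌋ − ⌊t_ν∕Lc⌋` (D1's staircase) — and so is the constant slot (`1 = (t + e_ν)_ν − t_ν`); L1′ therefore values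
BOTH the full slot sum and the face-gated slot sum of `V_j` as commutators of the value Hessian with the coordinate ∕ the staircase.  No tower, no descent by `SpureRecAt_succ`: the three
`τ` pairings of `ExchangeE2E2Channel.exchangeWord_sector_eq` and the `e–e` channel merge into ONE current per side, an `E2_{j+1}`-image of the profile «staircase × exit face».
* §1 **`slotSum_e3OfK_eq_coord`** — `Σ'_t V_j ν t (x,z)_{inl a, inl b} = ½·E2 d Lc (j+1) (x,z)_{ab}·(z_ν − x_ν)`; corollary **`sandwich_gaugeStencil_inr_inr`** — gen 52's tower object
  `(G_j ∘ 𝒮_ν[S_j] ∘ G_j)(Lc•x, Lc•z)_{inr a, inr b} = −½·E2 d Lc (j+1) (x,z)_{ab}·(z_ν − x_ν)` (with `ConstantSlotGaugeTower.tsum_slot_e3OfK_inl_inl`): the tower is summed.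
* §2 **`faceSlot_e3OfK_eq_stair`** — `Σ'_t χ_ν(t)·V_j ν t (x,z)_{inl a, inl b} = ½·E2 d Lc (j+1) (x,z)_{ab}·(⌊z_ν∕Lc⌋ − ⌊x_ν∕Lc⌋)`.
* §3 **`faceface_e3OfK_eq_stair`** (right current, open first leg), **`faceface_e3OfK_eq_stair_fst`** (left current, open second leg) — the two-face half-vertices of
  `ExchangeWordCellPairing.exchangeWord_eq_cellPairing` for the table `V_j`, in closed form (statements in the title; the `⌊z_ν∕Lc⌋`-halves die by D1).
WHERE IT SITS: with `ExchangeWordCellPairing` (generic `S`) and `ExchangeE2E2Channel` §1 (the E-sector table `cE • V_j` is admissible) the E-sector EE word of (C) at level `j+1` becomes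
a quadratic expression in `E2_{j+1}` and `G_{j+1}` alone (next file `ExchangeESectorStaircase`); the value (`κ_j`-form, p2's `|A∧a|²` tensor) then follows from L4′ and the
antisymmetry `E2(⌊·_ν∕Lc⌋·χ_β) = −E2(⌊·_β∕Lc⌋·χ_ν)ᵀ-twin` (E2 kills `d(⌊·_ν∕Lc⌋·⌊·_β∕Lc⌋)`).  Asserts NO value of Bałaban's tables beyond these identities; discharges NOTHING of
(C) ∕ (C)sym ∕ (Q-L) ∕ «T2Shape» ∕ «T2Drift» ∕ (hW, hWall); NEVER «G-an2-4 closed» as (CONV-C); NOT D1, NOT `BetaPertH`, NOT continuum, NOT Clay.  2026-08-23; no existing file touched.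
-/

noncomputable section

open Finset
open scoped BigOperators
open Literature.MathematicalPhysics.QuantumFieldTheory
open Literature.MathematicalPhysics.QuantumFieldTheory.Balaban1983to89
open Literature.MathematicalPhysics.QuantumFieldTheory.Balaban1983to89.Beta
open B12Sec2to5 (l1 l1_nonneg abs_coord_le_l1)
open ExpKernelCalculus (Site MKer comp)
open AffineAveraging (box toSite unitVec)
open OneStepResolventKernel (Fib LocStencil)
open OneStepKernelFamily (KInvStep)
open BalabanStepJetsSucc (E2)
open Summit.QuantumFields.BalabanUV.Beta.AxialDressingRooted (coDressKBmAt one_le_of_neZero)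
open Summit.QuantumFields.BalabanUV.Beta.SpineRooted (e3OfK)
open Summit.QuantumFields.BalabanUV.Beta.WardLocusRecursive (SrecAt locStencil_SrecAt)
open Summit.QuantumFields.BalabanUV.Beta.GAN24.ValueHessianLinearGauge (staircase_grad abs_staircase_le tsum_E2_mul_exitFace_eq_zero' tsum_exitFace_mul_E2_eq_zero')
open Summit.QuantumFields.BalabanUV.Beta.GAN24.CubicGaugeLetterLinearGrowth (tsum_grad_mul_e3OfK_SrecAt_inl_inl)
open Summit.QuantumFields.BalabanUV.Beta.GAN24.ExitFaceHalfVertexSplit (summable_E2_mul_linGrowth_face summable_linGrowth_face_mul_E2)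
open Summit.QuantumFields.BalabanUV.Beta.GAN24.ConstantSlotGaugeTower (tsum_slot_e3OfK_inl_inl)

namespace Summit.QuantumFields.BalabanUV.Beta.GAN24.ExitFaceSlotStaircase

variable {d : ℕ} {Lc : ℕ} [NeZero Lc] {r : Fin (d + 1) → ℕ}

/-! ## §0 The two gauge functions: coordinate and staircase -/

/-- [folklore] The coordinate's gradient is the unit constant form: `(t + e_κ)_ν − t_ν = [κ = ν]` (as reals). -/
theorem coord_grad (ν κ : Fin (d + 1)) (t : Fin (d + 1) → ℤ) :
    (((t + unitVec κ) ν : ℤ) : ℝ) - ((t ν : ℤ) : ℝ) = if κ = ν then 1 else 0 := by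
  by_cases hκ : κ = ν
  · subst hκ
    simp only [Pi.add_apply, AffineAveraging.unitVec, Pi.single_eq_same, if_true]
    push_cast
    ring
  · have e : (t + unitVec κ) ν = t ν := by
      simp only [Pi.add_apply, AffineAveraging.unitVec, Pi.single_apply, if_neg (Ne.symm hκ), add_zero]
    rw [e, sub_self, if_neg hκ]

/-- [folklore] Linear growth of the coordinate: `|t_ν| ≤ 0 + 1·|t|₁`. -/
theorem abs_coord_le (ν : Fin (d + 1)) (t : Fin (d + 1) → ℤ) : |((t ν : ℤ) : ℝ)| ≤ 0 + 1 * l1 t := by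
  rw [zero_add, one_mul]
  exact abs_coord_le_l1 t ν

omit [NeZero Lc] in
/-- [folklore] The staircase's gradient is the exit-face indicator: `⌊(t + e_κ)_ν∕Lc⌋ − ⌊t_ν∕Lc⌋ = [κ = ν]·χ_ν(t)` (`1 ≤ Lc`; D1 `staircase_grad` at weight `1`). -/
theorem stair_grad (hLc : 1 ≤ Lc) (ν κ : Fin (d + 1)) (t : Fin (d + 1) → ℤ) :
    ((((t + unitVec κ) ν / (Lc : ℤ) : ℤ) : ℝ)) - (((t ν / (Lc : ℤ) : ℤ) : ℝ)) =
      if κ = ν then (if t ν % (Lc : ℤ) = (Lc : ℤ) - 1 then 1 else 0) else 0 := by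
  have h := staircase_grad (d := d) hLc 1 ν t κ
  rwa [one_mul, one_mul] at h

omit [NeZero Lc] in
/-- [folklore] Linear growth of the staircase: `|⌊t_ν∕Lc⌋| ≤ 0 + 1·|t|₁`. -/
theorem abs_stair_le (ν : Fin (d + 1)) (t : Fin (d + 1) → ℤ) : |(((t ν / (Lc : ℤ) : ℤ) : ℝ))| ≤ 0 + 1 * l1 t := by
  have h := abs_staircase_le (d := d) Lc 1 ν t
  rwa [one_mul, abs_one] at h

/-! ## §1 The full slot sum: the commutator of the value Hessian with the coordinate -/

/-- [folklore] **THE FULL SLOT SUM OF THE VALUE THIRD JET, IN CLOSED FORM** (every `j`, in-block root `toSite r`, pins `(cE, cVH) = (Lc^{d+1}, −Lc^{d+1}·½·Lc^{d+1})`, any `cΛ`):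
`Σ'_t V_j ν t (x,z)_{inl a, inl b} = ½·E2 d Lc (j+1) (x,z)_{ab}·(z_ν − x_ν)` — L1′ with the coordinate `g(t) = t_ν` (its gradient is the unit constant slot in direction `ν`). -/
theorem slotSum_e3OfK_eq_coord (hr : r ∈ box (d + 1) Lc) (cΛ : ℝ) (j : ℕ) (ν : Fin (d + 1)) (x z : Fin (d + 1) → ℤ) (a b : Fin (d + 1)) :
    ∑' t : Fin (d + 1) → ℤ, e3OfK Lc (coDressKBmAt (toSite r) Lc (KInvStep (d := d) Lc j))
        (SrecAt d Lc (toSite r) ((Lc : ℝ) ^ (d + 1)) (-((Lc : ℝ) ^ (d + 1) * (1 / 2) * (Lc : ℝ) ^ (d + 1))) cΛ j) ν t x z (Sum.inl a) (Sum.inl b) =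
      (1 / 2 : ℝ) * E2 d Lc (j + 1) x z (Sum.inl a) (Sum.inl b) * (((z ν : ℤ) : ℝ) - ((x ν : ℤ) : ℝ)) := by
  have key := tsum_grad_mul_e3OfK_SrecAt_inl_inl (d := d) hr cΛ j (g := fun t : Fin (d + 1) → ℤ => ((t ν : ℤ) : ℝ)) (abs_coord_le ν) x z a b
  rw [← key]
  refine tsum_congr fun t => ?_
  rw [Finset.sum_eq_single ν (fun κ _ hκ => by rw [coord_grad ν κ t, if_neg hκ, zero_mul]) (fun h => absurd (Finset.mem_univ ν) h),
    coord_grad ν ν t, if_pos rfl, one_mul]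

/-- [folklore] **GEN 52's TOWER OBJECT, SUMMED**: the multiplier block of the sandwiched gauge stencil `G_j ∘ 𝒮_ν[S_j] ∘ G_j` at the dilated points
(`ConstantSlotGaugeTower.tsum_slot_e3OfK_inl_inl`: it is `−Σ'_t V_j ν t (x,z)_{inl a, inl b}`) is `−½·E2 d Lc (j+1) (x,z)_{ab}·(z_ν − x_ν)`. -/
theorem sandwich_gaugeStencil_inr_inr (hr : r ∈ box (d + 1) Lc) (cΛ : ℝ) (j : ℕ) (ν : Fin (d + 1)) (x z : Fin (d + 1) → ℤ) (a b : Fin (d + 1)) :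
    comp (comp (coDressKBmAt (toSite r) Lc (KInvStep (d := d) Lc j))
        (fun p q c e => ((Lc : ℝ) * ((1 : ℝ) * 1)) * ((((Lc ^ (j + 1) : ℕ) : ℝ)) ^ (d + 1 + 1))⁻¹ *
          ∑' t : Fin (d + 1) → ℤ, (if t ν % (Lc : ℤ) = (Lc : ℤ) - 1 then
            SrecAt d Lc (toSite r) ((Lc : ℝ) ^ (d + 1)) (-((Lc : ℝ) ^ (d + 1) * (1 / 2) * (Lc : ℝ) ^ (d + 1))) cΛ j ν t p q c e else 0)))
        (coDressKBmAt (toSite r) Lc (KInvStep (d := d) Lc j)) ((Lc : ℤ) • x) ((Lc : ℤ) • z) (Sum.inr a) (Sum.inr b) =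
      -((1 / 2 : ℝ) * E2 d Lc (j + 1) x z (Sum.inl a) (Sum.inl b) * (((z ν : ℤ) : ℝ) - ((x ν : ℤ) : ℝ))) := by
  have hLc : 1 ≤ Lc := one_le_of_neZero Lc
  obtain ⟨Cs, δs, hδs, hS⟩ := locStencil_SrecAt (d := d) hLc hr ((Lc : ℝ) ^ (d + 1)) (-((Lc : ℝ) ^ (d + 1) * (1 / 2) * (Lc : ℝ) ^ (d + 1))) cΛ j
  have h := tsum_slot_e3OfK_inl_inl hr hS hδs j ν x z a b
  rw [slotSum_e3OfK_eq_coord hr cΛ j ν x z a b] at h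
  linarith

/-! ## §2 The face-gated slot sum: the commutator of the value Hessian with the staircase -/

/-- [folklore] **THE EXIT-FACE-GATED SLOT SUM OF THE VALUE THIRD JET, IN CLOSED FORM** (every `j`, in-block root, pins as above, any `cΛ`):
`Σ'_t χ_ν(t)·V_j ν t (x,z)_{inl a, inl b} = ½·E2 d Lc (j+1) (x,z)_{ab}·(⌊z_ν∕Lc⌋ − ⌊x_ν∕Lc⌋)` — L1′ with the staircase `g(t) = ⌊t_ν∕Lc⌋` (its gradient is the exit-face slot). -/
theorem faceSlot_e3OfK_eq_stair (hr : r ∈ box (d + 1) Lc) (cΛ : ℝ) (j : ℕ) (ν : Fin (d + 1)) (x z : Fin (d + 1) → ℤ) (a b : Fin (d + 1)) :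
    (∑' t : Fin (d + 1) → ℤ, (if t ν % (Lc : ℤ) = (Lc : ℤ) - 1 then
        e3OfK Lc (coDressKBmAt (toSite r) Lc (KInvStep (d := d) Lc j))
          (SrecAt d Lc (toSite r) ((Lc : ℝ) ^ (d + 1)) (-((Lc : ℝ) ^ (d + 1) * (1 / 2) * (Lc : ℝ) ^ (d + 1))) cΛ j) ν t x z (Sum.inl a) (Sum.inl b) else 0)) =
      (1 / 2 : ℝ) * E2 d Lc (j + 1) x z (Sum.inl a) (Sum.inl b) * ((((z ν / (Lc : ℤ) : ℤ) : ℝ)) - (((x ν / (Lc : ℤ) : ℤ) : ℝ))) := by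
  have hLc : 1 ≤ Lc := one_le_of_neZero Lc
  have key := tsum_grad_mul_e3OfK_SrecAt_inl_inl (d := d) hr cΛ j (g := fun t : Fin (d + 1) → ℤ => (((t ν / (Lc : ℤ) : ℤ) : ℝ))) (abs_stair_le ν) x z a b
  rw [← key]
  refine tsum_congr fun t => ?_
  rw [Finset.sum_eq_single ν (fun κ _ hκ => by rw [stair_grad hLc ν κ t, if_neg hκ, zero_mul]) (fun h => absurd (Finset.mem_univ ν) h),
    stair_grad hLc ν ν t, if_pos rfl]
  split_ifs
  · rw [one_mul]
  · rw [zero_mul]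

/-! ## §3 The two-face currents of the E-sector EE word are value-Hessian images of «staircase × exit face» -/

/-- [folklore] **THE RIGHT TWO-FACE CURRENT IN CLOSED FORM** (open first leg `(b, z)`, exit-face weight `χ_β` on the second leg, face-gated slot in direction `ν`):
`Σ'_{s′} χ_β(s′)·Σ'_t χ_ν(t)·V_j ν t (z,s′)_{inl b, inl β} = ½·Σ'_{s′} E2 d Lc (j+1) (z,s′)_{bβ}·(⌊s′_ν∕Lc⌋·χ_β(s′))` — §2 pointwise in `s′`; the `⌊z_ν∕Lc⌋`-half is
`⌊z_ν∕Lc⌋·Σ'_{s′} E2(z,s′)_{bβ}·χ_β(s′) = 0` (D1: the value Hessian kills the exit-face profile). -/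
theorem faceface_e3OfK_eq_stair (hr : r ∈ box (d + 1) Lc) (cΛ : ℝ) (j : ℕ) (ν β : Fin (d + 1)) (z : Fin (d + 1) → ℤ) (b : Fin (d + 1)) :
    (∑' s' : Fin (d + 1) → ℤ, (if s' β % (Lc : ℤ) = (Lc : ℤ) - 1 then (1 : ℝ) else 0) *
        ∑' t : Fin (d + 1) → ℤ, (if t ν % (Lc : ℤ) = (Lc : ℤ) - 1 then
          e3OfK Lc (coDressKBmAt (toSite r) Lc (KInvStep (d := d) Lc j))
            (SrecAt d Lc (toSite r) ((Lc : ℝ) ^ (d + 1)) (-((Lc : ℝ) ^ (d + 1) * (1 / 2) * (Lc : ℝ) ^ (d + 1))) cΛ j) ν t z s' (Sum.inl b) (Sum.inl β) else 0)) =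
      (1 / 2 : ℝ) * ∑' s' : Fin (d + 1) → ℤ, E2 d Lc (j + 1) z s' (Sum.inl b) (Sum.inl β) *
        ((((s' ν / (Lc : ℤ) : ℤ) : ℝ)) * (if s' β % (Lc : ℤ) = (Lc : ℤ) - 1 then (1 : ℝ) else 0)) := by
  have hLc : 1 ≤ Lc := one_le_of_neZero Lc
  have hpt : ∀ s' : Fin (d + 1) → ℤ, (if s' β % (Lc : ℤ) = (Lc : ℤ) - 1 then (1 : ℝ) else 0) *
      (∑' t : Fin (d + 1) → ℤ, (if t ν % (Lc : ℤ) = (Lc : ℤ) - 1 then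
        e3OfK Lc (coDressKBmAt (toSite r) Lc (KInvStep (d := d) Lc j))
          (SrecAt d Lc (toSite r) ((Lc : ℝ) ^ (d + 1)) (-((Lc : ℝ) ^ (d + 1) * (1 / 2) * (Lc : ℝ) ^ (d + 1))) cΛ j) ν t z s' (Sum.inl b) (Sum.inl β) else 0)) =
      (1 / 2 : ℝ) * (E2 d Lc (j + 1) z s' (Sum.inl b) (Sum.inl β) * ((((s' ν / (Lc : ℤ) : ℤ) : ℝ)) * (if s' β % (Lc : ℤ) = (Lc : ℤ) - 1 then (1 : ℝ) else 0)))
        - (1 / 2 : ℝ) * (E2 d Lc (j + 1) z s' (Sum.inl b) (Sum.inl β) * (if s' β % (Lc : ℤ) = (Lc : ℤ) - 1 then (((z ν / (Lc : ℤ) : ℤ) : ℝ)) else 0)) := by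
    intro s'
    rw [faceSlot_e3OfK_eq_stair hr cΛ j ν z s' b β]
    split_ifs <;> ring
  have h1 := summable_E2_mul_linGrowth_face (d := d) (Lc := Lc) j (lam := fun s : Fin (d + 1) → ℤ => (((s ν / (Lc : ℤ) : ℤ) : ℝ))) (abs_stair_le ν) z b β
  have h2 : Summable fun s' : Fin (d + 1) → ℤ =>
      E2 d Lc (j + 1) z s' (Sum.inl b) (Sum.inl β) * (if s' β % (Lc : ℤ) = (Lc : ℤ) - 1 then (((z ν / (Lc : ℤ) : ℤ) : ℝ)) else 0) := by
    have h := summable_E2_mul_linGrowth_face (d := d) (Lc := Lc) j (lam := fun _ : Fin (d + 1) → ℤ => (((z ν / (Lc : ℤ) : ℤ) : ℝ)))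
      (A := |(((z ν / (Lc : ℤ) : ℤ) : ℝ))|) (B := 0) (fun _ => by rw [zero_mul, add_zero]) z b β
    refine h.congr fun s' => ?_
    split_ifs <;> simp
  rw [tsum_congr hpt, (h1.mul_left (1 / 2 : ℝ)).tsum_sub (h2.mul_left (1 / 2 : ℝ)), tsum_mul_left, tsum_mul_left,
    tsum_E2_mul_exitFace_eq_zero' (Lc := Lc) (j + 1) hLc b β z ((((z ν / (Lc : ℤ) : ℤ) : ℝ))), mul_zero, sub_zero]

/-- [folklore] **THE LEFT TWO-FACE CURRENT IN CLOSED FORM** (exit-face weight `χ_α` on the first leg, open second leg `(a, x)`, face-gated slot in direction `μ`):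
`Σ'_y χ_α(y)·Σ'_t χ_μ(t)·V_j μ t (y,x)_{inl α, inl a} = −½·Σ'_y (⌊y_μ∕Lc⌋·χ_α(y))·E2 d Lc (j+1) (y,x)_{αa}` — §2 at the legs `(y, x)`; the `⌊x_μ∕Lc⌋`-half dies by
D1's row form. -/
theorem faceface_e3OfK_eq_stair_fst (hr : r ∈ box (d + 1) Lc) (cΛ : ℝ) (j : ℕ) (μ α : Fin (d + 1)) (x : Fin (d + 1) → ℤ) (a : Fin (d + 1)) :
    (∑' y : Fin (d + 1) → ℤ, (if y α % (Lc : ℤ) = (Lc : ℤ) - 1 then (1 : ℝ) else 0) *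
        ∑' t : Fin (d + 1) → ℤ, (if t μ % (Lc : ℤ) = (Lc : ℤ) - 1 then
          e3OfK Lc (coDressKBmAt (toSite r) Lc (KInvStep (d := d) Lc j))
            (SrecAt d Lc (toSite r) ((Lc : ℝ) ^ (d + 1)) (-((Lc : ℝ) ^ (d + 1) * (1 / 2) * (Lc : ℝ) ^ (d + 1))) cΛ j) μ t y x (Sum.inl α) (Sum.inl a) else 0)) =
      -(1 / 2 : ℝ) * ∑' y : Fin (d + 1) → ℤ, ((((y μ / (Lc : ℤ) : ℤ) : ℝ)) * (if y α % (Lc : ℤ) = (Lc : ℤ) - 1 then (1 : ℝ) else 0)) *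
        E2 d Lc (j + 1) y x (Sum.inl α) (Sum.inl a) := by
  have hLc : 1 ≤ Lc := one_le_of_neZero Lc
  have hpt : ∀ y : Fin (d + 1) → ℤ, (if y α % (Lc : ℤ) = (Lc : ℤ) - 1 then (1 : ℝ) else 0) *
      (∑' t : Fin (d + 1) → ℤ, (if t μ % (Lc : ℤ) = (Lc : ℤ) - 1 then
        e3OfK Lc (coDressKBmAt (toSite r) Lc (KInvStep (d := d) Lc j))
          (SrecAt d Lc (toSite r) ((Lc : ℝ) ^ (d + 1)) (-((Lc : ℝ) ^ (d + 1) * (1 / 2) * (Lc : ℝ) ^ (d + 1))) cΛ j) μ t y x (Sum.inl α) (Sum.inl a) else 0)) =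
      (1 / 2 : ℝ) * ((if y α % (Lc : ℤ) = (Lc : ℤ) - 1 then (((x μ / (Lc : ℤ) : ℤ) : ℝ)) else 0) * E2 d Lc (j + 1) y x (Sum.inl α) (Sum.inl a))
        - (1 / 2 : ℝ) * (((((y μ / (Lc : ℤ) : ℤ) : ℝ)) * (if y α % (Lc : ℤ) = (Lc : ℤ) - 1 then (1 : ℝ) else 0)) * E2 d Lc (j + 1) y x (Sum.inl α) (Sum.inl a)) := by
    intro y
    rw [faceSlot_e3OfK_eq_stair hr cΛ j μ y x α a]
    split_ifs <;> ring
  have h2 := summable_linGrowth_face_mul_E2 (d := d) (Lc := Lc) j (lam := fun y : Fin (d + 1) → ℤ => (((y μ / (Lc : ℤ) : ℤ) : ℝ))) (abs_stair_le μ) x α a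
  have h1 : Summable fun y : Fin (d + 1) → ℤ =>
      (if y α % (Lc : ℤ) = (Lc : ℤ) - 1 then (((x μ / (Lc : ℤ) : ℤ) : ℝ)) else 0) * E2 d Lc (j + 1) y x (Sum.inl α) (Sum.inl a) := by
    have h := summable_linGrowth_face_mul_E2 (d := d) (Lc := Lc) j (lam := fun _ : Fin (d + 1) → ℤ => (((x μ / (Lc : ℤ) : ℤ) : ℝ)))
      (A := |(((x μ / (Lc : ℤ) : ℤ) : ℝ))|) (B := 0) (fun _ => by rw [zero_mul, add_zero]) x α a
    refine h.congr fun y => ?_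
    split_ifs <;> simp
  rw [tsum_congr hpt, (h1.mul_left (1 / 2 : ℝ)).tsum_sub (h2.mul_left (1 / 2 : ℝ)), tsum_mul_left, tsum_mul_left,
    tsum_exitFace_mul_E2_eq_zero' (Lc := Lc) (j + 1) hLc a α x ((((x μ / (Lc : ℤ) : ℤ) : ℝ))), mul_zero, zero_sub, neg_mul]

end Summit.QuantumFields.BalabanUV.Beta.GAN24.ExitFaceSlotStaircase

end
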